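import Literature.NumberTheory.Automorphic.SatakeParametersGLXiRecursion
import Literature.NumberTheory.Automorphic.SphericalHeckeEigenvaluesGL
import HarnessLib

/-!
# The Harish-Chandra sum of `GL_n`: evaluation of `𝒮` at the trivial tempered point, submultiplicativity, and the degree bound

Topic `NumberTheory/Automorphic`; third file of the proof of the direction "unitary Satake
parameters ⇒ tempered" of the named fact
`Literature.NumberTheory.Automorphic.isTempered_iff_forall_norm_eq_one` (`SatakeParametersGL`),
on top of `SatakeParametersGLXiRecursion` (the Harish-Chandra sum
`xiSum hϖ Q g = ∑_{c ∈ KgK/K} Q^{-2⟨ρ, e(c)⟩}`, `Q = √q`, and its estimate on `K ϖ^λ K`) and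
`SphericalHeckeEigenvaluesGL` (evaluation `laurentEvalAt` of the Satake transform `𝒮`).
Setting: a non-archimedean local field `F`, `K = GL_n(𝒪)`.

* `trivialTemperedPoint n F = (Q^{n-1}, …, Q^{n-1}) ∈ (ℂˣ)ⁿ`, the Satake point of the trivially
  induced (tempered, spherical) representation in the normalisation of `laurentEvalAt`, and
  **`𝒮(T_g)(Q^{n-1}, …, Q^{n-1}) = xiSum hϖ Q g`**
  (`laurentEvalAt_trivialTemperedPoint_satakeTransform`): the Harish-Chandra sum is a character
  of the spherical Hecke algebra.
* **Submultiplicativity** (`xiSum_mul_le`): `Ξ-sum(h g) ≤ Ξ-sum(g) Ξ-sum(h)`, and for the degrees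
  `#(K hg K/K) ≤ #(KgK/K) #(KhK/K)` (`card_orbit_mul_le`): the cosets `β̃ α`, `β ∈ KhK/K`,
  `α ∈ KgK/K`, of the product expansion of `T_g T_h [K]` (`HeckeDoubleCosetOperators`) cover
  `K hg K / K`, all weights being non-negative.  Consequently two-sided translates of
  `Ξ-sum/deg` are dominated by multiples of itself (`xiSum_div_card_mul_mul_le`).
* **The degree bound** (`sqrtResidueCard_zpow_le_card_orbit`): `#(K ϖ^λ K / K) ≥ q^{2⟨ρ, λ⟩}`
  (i.e. `≥ Q^{2·twoRho λ}`), because the coefficients of `𝒮(T_{ϖ^λ})` are `S_n`-symmetric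
  (Satake isomorphism, `SatakeParametersGLIsoProofs`, `SymmLaurentWeylInvariants`): the number of
  cosets in `K ϖ^λ K` with Iwasawa exponent `λ` is `q^{⟨ν, λ⟩ - ⟨ν, λ ∘ rev⟩} = q^{2⟨ρ,λ⟩}`
  times the (positive) number with exponent `λ ∘ rev`.  (Macdonald (1995), Ch. V (2.9) gives the
  exact value `q^{2⟨ρ,λ⟩} v_n(q⁻¹)/v_λ(q⁻¹)`; only the lower bound is needed.)

## References

* I. G. Macdonald, *Symmetric functions and Hall polynomials*, 2nd ed. (1995), Ch. V, (2.6),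
  (2.9), (3.3) [Macdonald1995].
* P. Cartier, *Representations of 𝔭-adic groups: a survey*, Proc. Sympos. Pure Math. 33 (1979),
  part 1, §IV [CartierCorvallis1979].
-/

noncomputable section

open scoped Pointwise MatrixGroups
open MulAction ValuativeRel Matrix Finset MonoidAlgebra Representation

universe u

namespace Literature.NumberTheory.Automorphic

/-! ### The trivial tempered point and the identity `𝒮(T_g)(z₀) = Ξ-sum(g)` -/

section Point

variable {n : ℕ}

/-- `2⟨ρ, e⟩ = 2⟨ν, e⟩ - (n-1)|e|` with `ν = (n-1, …, 0)` (`satakeTwistExp`). [folklore] -/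
theorem twoRho_eq_two_mul_satakeTwistExp_sub (e : Fin n → ℤ) :
    twoRho e = 2 * satakeTwistExp e - ((n : ℤ) - 1) * ∑ i, e i := by
  rw [twoRho, satakeTwistExp, Finset.mul_sum, Finset.mul_sum, ← Finset.sum_sub_distrib]
  exact Finset.sum_congr rfl fun i _ => by ring

/-- `⟨ν, e⟩ - ⟨ν, e ∘ rev⟩ = 2⟨ρ, e⟩`. [folklore] -/
theorem satakeTwistExp_sub_satakeTwistExp_comp_rev (e : Fin n → ℤ) :
    satakeTwistExp e - satakeTwistExp (e ∘ Fin.rev) = twoRho e := by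
  rw [satakeTwistExp, satakeTwistExp, twoRho]
  have h : ∑ i : Fin n, ((n : ℤ) - 1 - (i : ℕ)) * (e ∘ Fin.rev) i =
      ∑ i : Fin n, ((i : ℕ) : ℤ) * e i := by
    rw [← Equiv.sum_comp Fin.revPerm]
    have hrev : ∀ i : Fin n, ((n : ℤ) - 1 - ((Fin.rev i : Fin n) : ℕ)) = ((i : ℕ) : ℤ) := by
      intro i
      rw [Fin.val_rev]
      omega
    refine Finset.sum_congr rfl fun i _ => ?_
    simp only [Fin.revPerm_apply, Function.comp_apply, Fin.rev_rev, hrev]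
  rw [h, ← Finset.sum_sub_distrib]
  exact Finset.sum_congr rfl fun i _ => by ring

variable (n) (F : Type u) [Field F] [ValuativeRel F]

/-- **The trivial tempered point** `z₀ = (Q^{n-1}, …, Q^{n-1}) ∈ (ℂˣ)ⁿ`, `Q = √q`: the point
`q^{(n-1)/2} α` of the trivial Satake parameters `α = (1, …, 1)` (the spherical vector of
`Ind_B^G δ_B^{1/2}`, whose zonal spherical function is Harish-Chandra's `Ξ`). [folklore] -/
def trivialTemperedPoint [Finite 𝓀[F]] : Fin n → ℂˣ := fun _ =>
  Units.mk0 (((sqrtResidueCard F : ℝ) : ℂ) ^ (n - 1))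
    (pow_ne_zero _ (by exact_mod_cast sqrtResidueCard_pos.ne'))

variable {n F}

/-- The coordinates of `z₀`. [folklore] -/
theorem trivialTemperedPoint_apply [Finite 𝓀[F]] (i : Fin n) :
    ((trivialTemperedPoint n F i : ℂˣ) : ℂ) = ((sqrtResidueCard F : ℝ) : ℂ) ^ (n - 1) :=
  rfl

/-- **The weight at the trivial tempered point**:
`q^{-⟨ν, e⟩} ∏_i (Q^{n-1})^{e_i} = Q^{-2⟨ρ, e⟩}` (as complex numbers). [folklore] -/
theorem satakeWeight_mul_prod_trivialTemperedPoint [Finite 𝓀[F]] (e : Fin n → ℤ) :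
    satakeWeight (Nat.card 𝓀[F] : ℂ) e * ∏ i, ((trivialTemperedPoint n F i : ℂˣ) : ℂ) ^ e i =
      ((xiWeight (sqrtResidueCard F) e : ℝ) : ℂ) := by
  have hQ : 0 < sqrtResidueCard F := sqrtResidueCard_pos
  have hQ0 : ((sqrtResidueCard F : ℝ) : ℂ) ≠ 0 := by exact_mod_cast hQ.ne'
  simp only [trivialTemperedPoint_apply]
  rw [prod_zpow_eq_zpow_sum (pow_ne_zero _ hQ0), satakeWeight, xiWeight,
    twoRho_eq_two_mul_satakeTwistExp_sub]
  have hq : ((Nat.card 𝓀[F] : ℕ) : ℂ) = ((sqrtResidueCard F : ℝ) : ℂ) ^ (2 : ℤ) := by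
    rw [← Complex.ofReal_natCast, ← sqrtResidueCard_sq]
    push_cast
    rfl
  rw [hq, ← _root_.zpow_mul, ← zpow_natCast (((sqrtResidueCard F : ℝ) : ℂ)) (n - 1),
    ← _root_.zpow_mul, ← zpow_add₀ hQ0, Complex.ofReal_zpow]
  congr 1
  rcases Nat.eq_zero_or_pos n with hn | hn
  · subst hn
    simp
  · rw [Nat.cast_sub hn]
    push_cast
    ring

end Point

/-! ### `Ξ-sum` through the Satake transform -/

section LocalField

variable {n : ℕ} {F : Type u} [Field F] [ValuativeRel F] [TopologicalSpace F]
  [IsNonarchimedeanLocalField F] {ϖ : F} (hϖ : IsUniformizingElement ϖ)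

/-- The linear functional `Ψ = ev_{z₀} ∘ satakeVec` on `ℂ[G ⧸ K]` takes `[γ]` to the weight
`Q^{-2⟨ρ, e(γ)⟩}`. [folklore] -/
theorem laurentEvalAt_trivialTemperedPoint_satakeVec_single (γ : GL (Fin n) F ⧸ glInt n F)
    (c : ℂ) :
    laurentEvalAt (trivialTemperedPoint n F) (satakeVec hϖ (single γ c)) =
      c * ((xiWeight (sqrtResidueCard F) (iwasawaExp hϖ γ.out) : ℝ) : ℂ) := by
  rw [satakeVec_single, laurentEvalAt_single, mul_assoc,
    satakeWeight_mul_prod_trivialTemperedPoint]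

/-- **`𝒮(T_g)(z₀) = Ξ-sum(g)`**: the Satake transform of `T_g` at the trivial tempered point is
the Harish-Chandra sum `∑_{c ∈ KgK/K} Q^{-2⟨ρ, e(c)⟩}`. [folklore] -/
theorem laurentEvalAt_trivialTemperedPoint_satakeTransform (g : GL (Fin n) F) :
    laurentEvalAt (trivialTemperedPoint n F)
        (satakeTransform hϖ (heckeAlgebra.doubleCosetOperator (glInt n F) g)) =
      ((xiSum hϖ (sqrtResidueCard F) g : ℝ) : ℂ) := by
  rw [satakeTransform_apply, heckeAlgebra.toVector_doubleCosetOperator,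
    heckeAlgebra.doubleCosetIndicator_eq_sum, map_sum, map_sum,
    xiSum_eq_sum hϖ _ (finite_orbit_quotient (glInt n F) g), Complex.ofReal_sum]
  refine Finset.sum_congr rfl fun γ _ => ?_
  rw [laurentEvalAt_trivialTemperedPoint_satakeVec_single, one_mul]

/-- `Ψ(T [K]) = 𝒮(T)(z₀)`. [folklore] -/
theorem laurentEvalAt_satakeVec_toVector (T : heckeAlgebra ℂ (GL (Fin n) F) (glInt n F)) :
    laurentEvalAt (trivialTemperedPoint n F) (satakeVec hϖ (heckeAlgebra.toVector (glInt n F) T)) =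
      laurentEvalAt (trivialTemperedPoint n F) (satakeTransform hϖ T) := by
  rw [satakeTransform_apply]

/-! ### Submultiplicativity -/

/-- **The product expansion** `(T_g T_h) [K] = ∑_{β ∈ KhK/K} ∑_{α ∈ KgK/K} [β̃ α]`
(`HeckeDoubleCosetOperators`). [folklore] -/
theorem toVector_doubleCosetOperator_mul_eq_sum_sum (g h : GL (Fin n) F) :
    heckeAlgebra.toVector (glInt n F) (heckeAlgebra.doubleCosetOperator (k := ℂ) (glInt n F) g *
        heckeAlgebra.doubleCosetOperator (glInt n F) h) =
      ∑ β ∈ (finite_orbit_quotient (glInt n F) h).toFinset,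
        ∑ α ∈ (finite_orbit_quotient (glInt n F) g).toFinset,
          single (β.out • α) (1 : ℂ) := by
  rw [heckeAlgebra.toVector_doubleCosetOperator_mul,
    heckeOperator_apply_eq_sum_out _ (glInt n F) h (finite_orbit_quotient (glInt n F) h)
      ((Representation.mem_fixedPoints _ (glInt n F) _).2 fun _ ha =>
        heckeAlgebra.ofMulAction_doubleCosetIndicator (glInt n F) g ha)]
  refine Finset.sum_congr rfl fun β _ => ?_
  rw [heckeAlgebra.doubleCosetIndicator_eq_sum, map_sum]
  refine Finset.sum_congr rfl fun α _ => ?_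
  rw [ofMulAction_single]

omit [TopologicalSpace F] [IsNonarchimedeanLocalField F] in
/-- **The cosets `β̃ α` cover `K hg K / K`**: for every `c ∈ K hg K / K` there are
`β ∈ KhK/K`, `α ∈ KgK/K` with `β̃ α = c`. [folklore] -/
theorem exists_out_smul_eq_of_mem_orbit_mul {g h : GL (Fin n) F} {c : GL (Fin n) F ⧸ glInt n F}
    (hc : c ∈ orbit (glInt n F) ((h * g : GL (Fin n) F) : GL (Fin n) F ⧸ glInt n F)) :
    ∃ β ∈ orbit (glInt n F) (h : GL (Fin n) F ⧸ glInt n F),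
      ∃ α ∈ orbit (glInt n F) (g : GL (Fin n) F ⧸ glInt n F), β.out • α = c := by
  obtain ⟨a, rfl⟩ := MulAction.mem_orbit_iff.1 hc
  obtain ⟨k₁, hk₁⟩ := QuotientGroup.mk_out_eq_mul (glInt n F) ((a : GL (Fin n) F) * h)
  refine ⟨(((a : GL (Fin n) F) * h : GL (Fin n) F) : GL (Fin n) F ⧸ glInt n F),
    MulAction.mem_orbit_iff.2 ⟨a, rfl⟩,
    (((k₁ : GL (Fin n) F)⁻¹ * g : GL (Fin n) F) : GL (Fin n) F ⧸ glInt n F),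
    MulAction.mem_orbit_iff.2 ⟨k₁⁻¹, rfl⟩, ?_⟩
  rw [hk₁, MulAction.Quotient.smul_mk, smul_eq_mul, subgroup_smul_mk]
  congr 1
  group

/-- **Submultiplicativity of the degrees**: `#(K hg K/K) ≤ #(KgK/K) · #(KhK/K)`. [folklore] -/
theorem card_orbit_mul_le (g h : GL (Fin n) F) :
    (finite_orbit_quotient (glInt n F) (h * g)).toFinset.card ≤
      (finite_orbit_quotient (glInt n F) g).toFinset.card *
        (finite_orbit_quotient (glInt n F) h).toFinset.card := by
  classical
  rw [mul_comm, ← Finset.card_product]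
  refine Finset.card_le_card_of_surjOn (fun p => p.1.out • p.2) fun c hc => ?_
  rw [Finset.mem_coe, Set.Finite.mem_toFinset] at hc
  obtain ⟨β, hβ, α, hα, hc⟩ := exists_out_smul_eq_of_mem_orbit_mul hc
  exact ⟨(β, α), Finset.mem_coe.2 (Finset.mem_product.2
    ⟨(Set.Finite.mem_toFinset _).2 hβ, (Set.Finite.mem_toFinset _).2 hα⟩), hc⟩

/-- **A non-negative function summed over `K hg K / K` is at most its sum over the pairs
`(β, α)`** (choose a preimage of each coset under `(β, α) ↦ β̃ α`). [folklore] -/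
theorem sum_orbit_mul_le_sum_sum {g h : GL (Fin n) F} {f : (GL (Fin n) F ⧸ glInt n F) → ℝ}
    (hf : ∀ c, 0 ≤ f c) :
    ∑ c ∈ (finite_orbit_quotient (glInt n F) (h * g)).toFinset, f c ≤
      ∑ β ∈ (finite_orbit_quotient (glInt n F) h).toFinset,
        ∑ α ∈ (finite_orbit_quotient (glInt n F) g).toFinset, f (β.out • α) := by
  classical
  -- a section of `(β, α) ↦ β̃ α` over `K hg K / K`
  have hsec : ∀ c ∈ (finite_orbit_quotient (glInt n F) (h * g)).toFinset,
      ∃ p : (GL (Fin n) F ⧸ glInt n F) × (GL (Fin n) F ⧸ glInt n F),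
        p ∈ (finite_orbit_quotient (glInt n F) h).toFinset ×ˢ
          (finite_orbit_quotient (glInt n F) g).toFinset ∧ p.1.out • p.2 = c := by
    intro c hc
    rw [Set.Finite.mem_toFinset] at hc
    obtain ⟨β, hβ, α, hα, hc⟩ := exists_out_smul_eq_of_mem_orbit_mul hc
    exact ⟨(β, α), Finset.mem_product.2
      ⟨(Set.Finite.mem_toFinset _).2 hβ, (Set.Finite.mem_toFinset _).2 hα⟩, hc⟩
  choose! s hs hsc using hsec
  have hinj : Set.InjOn s (finite_orbit_quotient (glInt n F) (h * g)).toFinset := by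
    intro c hc c' hc' hcc'
    rw [← hsc c hc, ← hsc c' hc', hcc']
  calc ∑ c ∈ (finite_orbit_quotient (glInt n F) (h * g)).toFinset, f c
      = ∑ c ∈ (finite_orbit_quotient (glInt n F) (h * g)).toFinset, f ((s c).1.out • (s c).2) :=
        Finset.sum_congr rfl fun c hc => by rw [hsc c hc]
    _ = ∑ p ∈ (finite_orbit_quotient (glInt n F) (h * g)).toFinset.image s, f (p.1.out • p.2) := by
        rw [Finset.sum_image hinj]
    _ ≤ ∑ p ∈ (finite_orbit_quotient (glInt n F) h).toFinset ×ˢ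
          (finite_orbit_quotient (glInt n F) g).toFinset, f (p.1.out • p.2) :=
        Finset.sum_le_sum_of_subset_of_nonneg (Finset.image_subset_iff.2 hs) fun p _ _ => hf _
    _ = _ := Finset.sum_product _ _ _

/-- **Submultiplicativity of the Harish-Chandra sum**: `Ξ-sum(h g) ≤ Ξ-sum(g) · Ξ-sum(h)`.
The product `Ξ-sum(g) Ξ-sum(h) = 𝒮(T_g T_h)(z₀)` (`𝒮` is multiplicative) is the sum of the
weights of the cosets `β̃ α` of the product expansion, which cover `K hg K / K`
(Macdonald (1995), Ch. V (2.6); Shimura (1971), Prop. 3.15). [cite: Macdonald1995, Ch. V (2.6)] -/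
theorem xiSum_mul_le (g h : GL (Fin n) F) :
    xiSum hϖ (sqrtResidueCard F) (h * g) ≤
      xiSum hϖ (sqrtResidueCard F) g * xiSum hϖ (sqrtResidueCard F) h := by
  have hQ : 0 < sqrtResidueCard F := sqrtResidueCard_pos
  -- the product as a double sum of weights
  have hprod : ((xiSum hϖ (sqrtResidueCard F) g * xiSum hϖ (sqrtResidueCard F) h : ℝ) : ℂ) =
      ∑ β ∈ (finite_orbit_quotient (glInt n F) h).toFinset,
        ∑ α ∈ (finite_orbit_quotient (glInt n F) g).toFinset,
          ((xiWeight (sqrtResidueCard F) (iwasawaExp hϖ (β.out • α).out) : ℝ) : ℂ) := by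
    rw [Complex.ofReal_mul, ← laurentEvalAt_trivialTemperedPoint_satakeTransform hϖ g,
      ← laurentEvalAt_trivialTemperedPoint_satakeTransform hϖ h, ← map_mul, ← map_mul,
      ← laurentEvalAt_satakeVec_toVector, toVector_doubleCosetOperator_mul_eq_sum_sum, map_sum,
      map_sum]
    refine Finset.sum_congr rfl fun β _ => ?_
    rw [map_sum, map_sum]
    refine Finset.sum_congr rfl fun α _ => ?_
    rw [laurentEvalAt_trivialTemperedPoint_satakeVec_single, one_mul]
  have hprod' : xiSum hϖ (sqrtResidueCard F) g * xiSum hϖ (sqrtResidueCard F) h =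
      ∑ β ∈ (finite_orbit_quotient (glInt n F) h).toFinset,
        ∑ α ∈ (finite_orbit_quotient (glInt n F) g).toFinset,
          xiWeight (sqrtResidueCard F) (iwasawaExp hϖ (β.out • α).out) := by
    apply Complex.ofReal_injective
    rw [hprod]
    push_cast
    rfl
  rw [hprod', xiSum_eq_sum hϖ _ (finite_orbit_quotient (glInt n F) (h * g))]
  exact sum_orbit_mul_le_sum_sum fun c => xiWeight_nonneg hQ.le _

/-- **Two-sided translates of `Ξ-sum/deg` are dominated by itself**:
`(Ξ-sum/deg)(h g g') ≤ Ξ-sum(h) Ξ-sum(g') deg(h⁻¹) deg(g'⁻¹) · (Ξ-sum/deg)(g)`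
(submultiplicativity of `Ξ-sum` upwards and of `deg` applied to `g = h⁻¹ (h g g') g'⁻¹`).
[folklore] -/
theorem xiSum_div_card_mul_mul_le (h g g' : GL (Fin n) F) :
    xiSum hϖ (sqrtResidueCard F) (h * g * g') /
        (finite_orbit_quotient (glInt n F) (h * g * g')).toFinset.card ≤
      (xiSum hϖ (sqrtResidueCard F) h * xiSum hϖ (sqrtResidueCard F) g' *
        ((finite_orbit_quotient (glInt n F) h⁻¹).toFinset.card *
          (finite_orbit_quotient (glInt n F) g'⁻¹).toFinset.card)) *
      (xiSum hϖ (sqrtResidueCard F) g / (finite_orbit_quotient (glInt n F) g).toFinset.card) := by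
  have hQ : 0 < sqrtResidueCard F := sqrtResidueCard_pos
  have hx0 : ∀ x : GL (Fin n) F, 0 ≤ xiSum hϖ (sqrtResidueCard F) x := fun x => xiSum_nonneg hϖ hQ.le x
  -- degrees are positive
  have hpos : ∀ x : GL (Fin n) F, 0 < ((finite_orbit_quotient (glInt n F) x).toFinset.card : ℝ) := by
    intro x
    exact_mod_cast Finset.card_pos.2 ⟨(x : GL (Fin n) F ⧸ glInt n F),
      (Set.Finite.mem_toFinset _).2 (MulAction.mem_orbit_self _)⟩
  -- `Ξ-sum(h g g') ≤ Ξ-sum(h) Ξ-sum(g) Ξ-sum(g')`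
  have h1 : xiSum hϖ (sqrtResidueCard F) (h * g * g') ≤
      xiSum hϖ (sqrtResidueCard F) h * xiSum hϖ (sqrtResidueCard F) g' *
        xiSum hϖ (sqrtResidueCard F) g := by
    calc xiSum hϖ (sqrtResidueCard F) (h * g * g')
        = xiSum hϖ (sqrtResidueCard F) (h * (g * g')) := by rw [mul_assoc]
      _ ≤ xiSum hϖ (sqrtResidueCard F) (g * g') * xiSum hϖ (sqrtResidueCard F) h :=
          xiSum_mul_le hϖ _ _
      _ ≤ (xiSum hϖ (sqrtResidueCard F) g' * xiSum hϖ (sqrtResidueCard F) g) *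
            xiSum hϖ (sqrtResidueCard F) h :=
          mul_le_mul_of_nonneg_right (xiSum_mul_le hϖ _ _) (hx0 _)
      _ = _ := by ring
  -- `deg(g) ≤ deg(h⁻¹) deg(g'⁻¹) deg(h g g')`
  have h2 : ((finite_orbit_quotient (glInt n F) g).toFinset.card : ℝ) ≤
      ((finite_orbit_quotient (glInt n F) h⁻¹).toFinset.card *
        (finite_orbit_quotient (glInt n F) g'⁻¹).toFinset.card) *
        (finite_orbit_quotient (glInt n F) (h * g * g')).toFinset.card := by
    have e1 := card_orbit_mul_le (h * g) h⁻¹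
    rw [inv_mul_cancel_left] at e1
    have e2 := card_orbit_mul_le g'⁻¹ (h * g * g')
    rw [mul_inv_cancel_right] at e2
    have e3 : (finite_orbit_quotient (glInt n F) g).toFinset.card ≤
        ((finite_orbit_quotient (glInt n F) h⁻¹).toFinset.card *
          (finite_orbit_quotient (glInt n F) g'⁻¹).toFinset.card) *
          (finite_orbit_quotient (glInt n F) (h * g * g')).toFinset.card :=
      calc (finite_orbit_quotient (glInt n F) g).toFinset.card
          ≤ (finite_orbit_quotient (glInt n F) (h * g)).toFinset.card *
              (finite_orbit_quotient (glInt n F) h⁻¹).toFinset.card := e1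
        _ ≤ ((finite_orbit_quotient (glInt n F) g'⁻¹).toFinset.card *
              (finite_orbit_quotient (glInt n F) (h * g * g')).toFinset.card) *
              (finite_orbit_quotient (glInt n F) h⁻¹).toFinset.card := Nat.mul_le_mul_right _ e2
        _ = _ := by ring
    exact_mod_cast e3
  -- combine
  rw [div_le_iff₀ (hpos _)]
  calc xiSum hϖ (sqrtResidueCard F) (h * g * g')
      ≤ xiSum hϖ (sqrtResidueCard F) h * xiSum hϖ (sqrtResidueCard F) g' *
          xiSum hϖ (sqrtResidueCard F) g := h1
    _ = xiSum hϖ (sqrtResidueCard F) h * xiSum hϖ (sqrtResidueCard F) g' *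
          (xiSum hϖ (sqrtResidueCard F) g / (finite_orbit_quotient (glInt n F) g).toFinset.card) *
          (finite_orbit_quotient (glInt n F) g).toFinset.card := by
        rw [mul_assoc _ (_ / _), div_mul_cancel₀ _ (hpos g).ne']
    _ ≤ xiSum hϖ (sqrtResidueCard F) h * xiSum hϖ (sqrtResidueCard F) g' *
          (xiSum hϖ (sqrtResidueCard F) g / (finite_orbit_quotient (glInt n F) g).toFinset.card) *
          (((finite_orbit_quotient (glInt n F) h⁻¹).toFinset.card *
            (finite_orbit_quotient (glInt n F) g'⁻¹).toFinset.card) *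
            (finite_orbit_quotient (glInt n F) (h * g * g')).toFinset.card) := by
        refine mul_le_mul_of_nonneg_left h2 ?_
        exact mul_nonneg (mul_nonneg (hx0 _) (hx0 _)) (div_nonneg (hx0 _) (hpos _).le)
    _ = _ := by ring

/-! ### The degree bound `#(K ϖ^λ K / K) ≥ q^{2⟨ρ, λ⟩}` -/

/-- **The Satake transform lands in the `S_n`-invariants** (Satake isomorphism of
`SatakeParametersGLIsoProofs`: `𝒮 ∘ θ = ι` with `θ` surjective and `ι` valued in
`ℂ[ℤⁿ]^{S_n}`). [folklore] -/
theorem satakeTransform_mem_weylInvariants (T : heckeAlgebra ℂ (GL (Fin n) F) (glInt n F)) :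
    satakeTransform hϖ T ∈
      weylInvariants ℂ (Fin n → ℤ) (ConnectedReductiveGroupData.glWeylGroup n) := by
  obtain ⟨x, rfl⟩ := SatakeGL.satakeInv_surjective hϖ T
  have h := AlgHom.congr_fun (SatakeGL.satakeTransform_comp_satakeInv (n := n) hϖ) x
  rw [AlgHom.comp_apply] at h
  rw [h]
  exact (SymmLaurent.lift n x).2

/-- **The coefficients of `𝒮(T)` are symmetric** under the coordinate permutations. [folklore] -/
theorem coeff_satakeTransform_comp_perm (T : heckeAlgebra ℂ (GL (Fin n) F) (glInt n F))
    (σ : Equiv.Perm (Fin n)) (μ : Fin n → ℤ) :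
    (satakeTransform hϖ T).coeff (μ ∘ σ) = (satakeTransform hϖ T).coeff μ := by
  have h := (SymmLaurent.mem_weylInvariants_gl_iff n _).1 (satakeTransform_mem_weylInvariants hϖ T) σ
  rw [SymmLaurent.domCongr_toAddEquiv_eq_self_iff] at h
  exact h μ

/-- **The coefficients of `𝒮(T_g)` count cosets by Iwasawa exponent**:
`𝒮(T_g)_μ = #{γ ∈ KgK/K : e(γ) = μ} · q^{-⟨ν, μ⟩}`. [folklore] -/
theorem coeff_satakeTransform_doubleCosetOperator (g : GL (Fin n) F) (μ : Fin n → ℤ) :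
    (satakeTransform hϖ (heckeAlgebra.doubleCosetOperator (glInt n F) g)).coeff μ =
      (((finite_orbit_quotient (glInt n F) g).toFinset.filter
          fun γ => iwasawaExp hϖ γ.out = μ).card : ℂ) * satakeWeight (Nat.card 𝓀[F] : ℂ) μ := by
  classical
  rw [satakeTransform_doubleCosetOperator, AddMonoidAlgebra.coeff_sum, Finset.sum_apply',
    Finset.card_eq_sum_ones, Nat.cast_sum, Finset.sum_mul, Finset.sum_filter]
  refine Finset.sum_congr rfl fun γ _ => ?_
  rw [AddMonoidAlgebra.coeff_single, Finsupp.single_apply]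
  by_cases h : iwasawaExp hϖ γ.out = μ
  · rw [if_pos h, if_pos h, h, Nat.cast_one, one_mul]
  · rw [if_neg h, if_neg h]

/-- **The antidominant coset**: `ϖ^{λ ∘ rev} K ⊆ K ϖ^λ K` has Iwasawa exponent `λ ∘ rev`, so the
number of cosets in `K ϖ^λ K` with exponent `λ ∘ rev` is positive. [folklore] -/
theorem one_le_card_filter_iwasawaExp_comp_rev (lam : Fin n → ℕ) :
    1 ≤ ((finite_orbit_quotient (glInt n F) (piPowGL hϖ.ne_zero lam)).toFinset.filter
      fun γ => iwasawaExp hϖ γ.out = (fun i => (lam i : ℤ)) ∘ Fin.rev).card := by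
  refine Finset.card_pos.2 ⟨((piPowGL hϖ.ne_zero (lam ∘ Fin.rev) : GL (Fin n) F) :
    GL (Fin n) F ⧸ glInt n F), Finset.mem_filter.2 ⟨?_, ?_⟩⟩
  · rw [Set.Finite.mem_toFinset]
    refine (heckeAlgebra.coe_mem_orbit_coe_iff _ _ _).2 ⟨permGL Fin.revPerm, permGL_mem_glInt _,
      (permGL Fin.revPerm)⁻¹, Subgroup.inv_mem _ (permGL_mem_glInt _), ?_⟩
    rw [permGL_mul_piPowGL_mul_inv]
    rfl
  · rw [iwasawaExp_out_coe, ← one_mul (piPowGL hϖ.ne_zero (lam ∘ Fin.rev)),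
      iwasawaExp_unipotent_mul_piPowGL hϖ (Subgroup.one_mem _)]
    rfl

/-- **The degree bound** `#(K ϖ^λ K / K) ≥ Q^{2·2⟨ρ,λ⟩} = q^{2⟨ρ, λ⟩}` for `λ ∈ ℕⁿ`: by the
symmetry of the coefficients of `𝒮(T_{ϖ^λ})`,
`#{e = λ} q^{-⟨ν,λ⟩} = #{e = λ ∘ rev} q^{-⟨ν, λ∘rev⟩}`, and `#{e = λ ∘ rev} ≥ 1`,
`⟨ν, λ⟩ - ⟨ν, λ ∘ rev⟩ = 2⟨ρ, λ⟩` (Macdonald (1995), Ch. V (2.9): the exact value is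
`q^{2⟨ρ,λ⟩} v_n(q⁻¹)/v_λ(q⁻¹)`). [cite: Macdonald1995, Ch. V (2.9)] -/
theorem sqrtResidueCard_zpow_le_card_orbit (lam : Fin n → ℕ) :
    sqrtResidueCard F ^ (2 * twoRho (fun i => (lam i : ℤ))) ≤
      ((finite_orbit_quotient (glInt n F) (piPowGL hϖ.ne_zero lam)).toFinset.card : ℝ) := by
  classical
  set μ : Fin n → ℤ := fun i => (lam i : ℤ) with hμ
  set O := (finite_orbit_quotient (glInt n F) (piPowGL hϖ.ne_zero lam)).toFinset with hO
  set N₁ := (O.filter fun γ => iwasawaExp hϖ γ.out = μ).card with hN₁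
  set N₂ := (O.filter fun γ => iwasawaExp hϖ γ.out = μ ∘ Fin.rev).card with hN₂
  have hq0 : ((Nat.card 𝓀[F] : ℕ) : ℂ) ≠ 0 := natCard_residueField_ne_zero
  -- symmetry of the coefficients
  have hsymm : (N₂ : ℂ) * satakeWeight (Nat.card 𝓀[F] : ℂ) (μ ∘ Fin.rev) =
      (N₁ : ℂ) * satakeWeight (Nat.card 𝓀[F] : ℂ) μ := by
    rw [hN₁, hN₂, hO, ← coeff_satakeTransform_doubleCosetOperator,
      ← coeff_satakeTransform_doubleCosetOperator]
    exact coeff_satakeTransform_comp_perm hϖ _ Fin.revPerm μ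
  -- hence `N₁ = N₂ q^{2⟨ρ,λ⟩}`
  have hN : (N₁ : ℂ) = (N₂ : ℂ) * (Nat.card 𝓀[F] : ℂ) ^ twoRho μ := by
    rw [satakeWeight, satakeWeight] at hsymm
    have hw : ((Nat.card 𝓀[F] : ℕ) : ℂ) ^ (-satakeTwistExp μ) ≠ 0 := zpow_ne_zero _ hq0
    calc (N₁ : ℂ) = (N₁ : ℂ) * ((Nat.card 𝓀[F] : ℕ) : ℂ) ^ (-satakeTwistExp μ) *
          ((Nat.card 𝓀[F] : ℕ) : ℂ) ^ (satakeTwistExp μ) := by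
          rw [mul_assoc, ← zpow_add₀ hq0, neg_add_cancel, zpow_zero, mul_one]
      _ = (N₂ : ℂ) * ((Nat.card 𝓀[F] : ℕ) : ℂ) ^ (-satakeTwistExp (μ ∘ Fin.rev)) *
          ((Nat.card 𝓀[F] : ℕ) : ℂ) ^ (satakeTwistExp μ) := by rw [← hsymm]
      _ = (N₂ : ℂ) * (Nat.card 𝓀[F] : ℂ) ^ twoRho μ := by
          rw [mul_assoc, ← zpow_add₀ hq0, ← satakeTwistExp_sub_satakeTwistExp_comp_rev]
          congr 2
          ring
  have hNreal : (N₁ : ℝ) = (N₂ : ℝ) * (Nat.card 𝓀[F] : ℝ) ^ twoRho μ := by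
    apply Complex.ofReal_injective
    push_cast
    exact hN
  have hN₂ : (1 : ℝ) ≤ N₂ := by exact_mod_cast one_le_card_filter_iwasawaExp_comp_rev hϖ lam
  have hq1 : (1 : ℝ) ≤ (Nat.card 𝓀[F] : ℝ) := by exact_mod_cast Nat.one_le_iff_ne_zero.2 Nat.card_pos.ne'
  calc sqrtResidueCard F ^ (2 * twoRho μ) = (Nat.card 𝓀[F] : ℝ) ^ twoRho μ :=
        (card_zpow_eq_sqrtResidueCard_zpow _).symm
    _ ≤ (N₂ : ℝ) * (Nat.card 𝓀[F] : ℝ) ^ twoRho μ :=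
        le_mul_of_one_le_left (zpow_nonneg (zero_le_one.trans hq1) _) hN₂
    _ = N₁ := hNreal.symm
    _ ≤ O.card := by exact_mod_cast Finset.card_filter_le _ _

end LocalField

end Literature.NumberTheory.Automorphic
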